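import Summits.QuantumFields.YangMills.Theorems.LangevinControlUVOSLegsFromFemtoAndGapDefs
import Summits.QuantumFields.YangMills.Theorems.LangevinControlUVOSLegsFromFemtoAndGapStubPinOfContinuous

/-!
# Sketch (crux-ideate, ideator 1, round 1) — crux `OSLegsAtWeakCouplingC` (stmt-QuantumFields-16207)
# Idea `inherited-amplitude-gates`: amplitude (and, for a density-typed H2, sign) are INHERITED from the
# periodic femto torus by solving the scale-free gate against the torus average; the conditional engine owes only
# η-RELATIVE gates, the one-point law FBL6 and flat-box shape facts.

Vocabulary: the landed Defs file of line `dlr-collar-transfer` (`TwoPoint`, `TwoPointPinned`, `FBL6`, `plane`,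
`dens`, `kerE`, `kerCov`, `depth`, `cubeEdges`).  Nothing is asserted: `Gate2`, `FlatShape2`, `FC2I` are Props;
`gate_solve_lower` / `gate_solve_upper` are the abstract real-inequality core of the inheritance step (proved);
`Statement.stub_inherit2` is the statement of the provable-now inheritance stub (H1 + continuity + FBL6 + Gate2 +
FlatShape2 ⇒ FC2I).
-/

set_option autoImplicit false

noncomputable section

open MeasureTheory Filter Topology
open Literature.MathematicalPhysics.QuantumFieldTheory Literature.MathematicalPhysics.QuantumLattice
open Literature.Probability.LatticeModels
open Summit.QuantumFields.YangMills.Cruxes.OSLegsFromFemtoAndGap.DlrCollarTransfer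

namespace Summit.QuantumFields.YangMills.Cruxes.OSLegsAtWeakCouplingC.InheritedGates

/-! ## §1 Abstract core: solving the gate for the flat-box value -/

/-- **Gate solve, lower half.**  If the exterior-averaged conditional covariance `e` (pinned from below by H1 on the
femto torus) obeys the upper gate `e ≤ C·k + C·M·√k` against the flat-box value `k ≥ 0`, and the budget `M` is small
(`C·M ≤ √(e/(2C)) / 2`-type), then `k ≥ e/(2C)`: the flat-box covariance inherits H1's lower bound. -/
theorem gate_solve_lower {e k C M : ℝ} (hC : 0 < C) (_hk : 0 ≤ k) (_hM : 0 ≤ M)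
    (hgate : e ≤ C * k + C * M * Real.sqrt k) (hbudget : C * M * Real.sqrt k ≤ e / 2) :
    e / (2 * C) ≤ k := by
  have h1 : e / 2 ≤ C * k := by linarith
  rw [div_le_iff₀ (by positivity)]
  linarith

/-- **Gate solve, upper half.**  If `e ≥ k·(1 − δ)` with `δ ≤ 1/2` (lower gate with small relative error) then
`k ≤ 2e`: the flat-box covariance inherits H1's upper bound. -/
theorem gate_solve_upper {e k δ : ℝ} (hk : 0 ≤ k) (hδ : δ ≤ 1 / 2) (hgate : k * (1 - δ) ≤ e) : k ≤ 2 * e := by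
  nlinarith

/-- **Propagation to every exterior.**  Once `k ∈ [e/(2C), 2e]` and the gate holds at `η` with relative error
`δ ≤ 1/2` below and factor `C(1+δ')`, `δ' ≤ 1`, above, `K(η) ∈ [e/(4C), 4Ce]`. -/
theorem gate_propagate {e k Kη C δ δ' : ℝ} (hC : 0 < C) (he : 0 ≤ e) (hk₁ : e / (2 * C) ≤ k) (hk₂ : k ≤ 2 * e)
    (hδ : δ ≤ 1 / 2) (hδ' : δ' ≤ 1) (hδ'0 : 0 ≤ δ') (hlow : k * (1 - δ) ≤ Kη) (hup : Kη ≤ C * k * (1 + δ')) :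
    e / (4 * C) ≤ Kη ∧ Kη ≤ 4 * C * e := by
  constructor
  · have hkpos : 0 ≤ k := le_trans (div_nonneg he (by positivity)) hk₁
    have : k / 2 ≤ Kη := by nlinarith
    have h2 : e / (4 * C) = (e / (2 * C)) / 2 := by ring
    rw [h2]; linarith
  · have : C * k * (1 + δ') ≤ C * (2 * e) * 2 := by
      apply mul_le_mul (mul_le_mul_of_nonneg_left hk₂ hC.le) (by linarith) (by linarith) (by positivity)
    linarith

/-! ## §2 The lattice Props (over the Defs vocabulary of line dlr-collar-transfer) -/

section Lattice

variable (G : Type) [Group G] [TopologicalSpace G] [IsTopologicalGroup G] [CompactSpace G]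
  [MeasurableSpace G] [BorelSpace G] (r : LatticeRep G) (a : ℝ → ℝ)

/-- **Gate2 — scale-free covariance gate for single-plane plaquette pairs in femto frozen cubes (ENGINE-GRADE,
η-RELATIVE).**  One universal `C` (before `∀ κ`): for every exterior `η`, every orientation `q`, every pair `x, y`
at depth `≥ κ‖y−x‖` in a femto cube, with `M` any bound on the conditional-mean shifts `|E_η P − E_1 P|` on the
sites of depth `≥ (κ−2)‖y−x‖`, the conditional covariance `K(η)` sits in
`[K(1)(1 − C(M/√K(1) + κ⁻⁴)), C·K(1)(1 + M/√K(1))]`, `K(1) > 0` the flat-exterior value.  No `a`-power, no `β`,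
no `Γ`: the exterior acts only through the background it induces, at second order (exact with `C = 2√2` in the
Gaussian proxy; ideator-2's `InfluenceGatedBallCovariance` of the predecessor crux, re-typed over cube kernels). -/
def Gate2 : Prop :=
  ∃ (C β₆ ℓ₆ : ℝ) (n₆ : ℕ), 0 < C ∧ 0 < ℓ₆ ∧ 1 ≤ n₆ ∧ ∀ β : ℝ, β₆ ≤ β → ∀ (κ : ℕ), 8 ≤ κ →
    ∀ (c : Fin 4 → ℤ) (b : ℕ), (b : ℝ) * a β ≤ ℓ₆ → ∀ (η : LGConfig 4 G) (q : Fin 4 × Fin 4), q.1 < q.2 →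
      ∀ (x y : Fin 4 → ℤ), (n₆ : ℝ) ≤ ‖siteToE (y - x)‖ →
        (κ : ℝ) * ‖siteToE (y - x)‖ ≤ depth c b x → (κ : ℝ) * ‖siteToE (y - x)‖ ≤ depth c b y →
        ∀ M : ℝ, 0 ≤ M →
          (∀ z : Fin 4 → ℤ, ((κ : ℝ) - 2) * ‖siteToE (y - x)‖ ≤ depth c b z →
            |kerE G r β c b η (plane G r q z) - kerE G r β c b 1 (plane G r q z)| ≤ M) →
          0 < kerCov G r β c b 1 (plane G r q x) (plane G r q y) ∧
          kerCov G r β c b 1 (plane G r q x) (plane G r q y) *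
              (1 - C * (M / Real.sqrt (kerCov G r β c b 1 (plane G r q x) (plane G r q y)) + 1 / (κ : ℝ) ^ 4)) ≤
            kerCov G r β c b η (plane G r q x) (plane G r q y) ∧
          kerCov G r β c b η (plane G r q x) (plane G r q y) ≤
            C * kerCov G r β c b 1 (plane G r q x) (plane G r q y) *
              (1 + M / Real.sqrt (kerCov G r β c b 1 (plane G r q x) (plane G r q y)))

/-- **FlatShape2 — dimensionless shape facts for the FLAT-walled femto box only (`η = 1`; toron-free: the flat
boundary kills the constant modes).**  (i) plane-sum / cross-term control and (ii) cone comparability, both as ONE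
comparison: the conditional covariance of the ACTION DENSITY at a pair `(x, y)` deep in the box is two-sidedly
comparable (factor `θ`) to the single-plane `(0,1)` conditional covariance at ANY axis pair `(x', x' + m e₂)` of
comparable length (`‖y−x‖ ≤ m ≤ 2‖y−x‖`) and comparable depth in the same box.  Tree level: `12/|x|⁸` vs `2/m⁸`
in every direction (sum of squares of the free `F`-propagator; checked numerically, folder k3tree.py). -/
def FlatShape2 : Prop :=
  ∃ (θ β₇ ℓ₇ : ℝ) (κ₇ n₇ : ℕ), 0 < θ ∧ 0 < ℓ₇ ∧ ∀ β : ℝ, β₇ ≤ β →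
    ∀ (c : Fin 4 → ℤ) (b : ℕ), (b : ℝ) * a β ≤ ℓ₇ → ∀ (x y x' : Fin 4 → ℤ) (m : ℕ),
      (n₇ : ℝ) ≤ ‖siteToE (y - x)‖ → ‖siteToE (y - x)‖ ≤ m → (m : ℝ) ≤ 2 * ‖siteToE (y - x)‖ →
      (κ₇ : ℝ) * m ≤ depth c b x → (κ₇ : ℝ) * m ≤ depth c b y →
      (κ₇ : ℝ) * m ≤ depth c b x' → (κ₇ : ℝ) * m ≤ depth c b (x' + Pi.single (2 : Fin 4) (m : ℤ)) →
        θ * kerCov G r β c b 1 (plane G r (0, 1) x') (plane G r (0, 1) (x' + Pi.single (2 : Fin 4) (m : ℤ))) ≤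
          kerCov G r β c b 1 (dens G r x) (dens G r y) ∧
        θ * kerCov G r β c b 1 (dens G r x) (dens G r y) ≤
          kerCov G r β c b 1 (plane G r (0, 1) x') (plane G r (0, 1) (x' + Pi.single (2 : Fin 4) (m : ℤ)))

/-- **FC2I — the INHERITED conditional two-point package** (what `stub_lower` consumes at its one chosen scale
window): for every exterior `η`, two-sided bounds `c₂ ≤ ‖y−x‖⁸·CondCov(dens_x, dens_y) ≤ C₂` whenever the physical
separation lies in the pinned window `[s₁, s₂]` and the collar depth `κ₂‖y−x‖` fits.  No shape function: the
constants absorb H1's `Γ` on `[s₁, s₂]` (interval pinning, landed `twoPointPinned_of_continuous`). -/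
def FC2I : Prop :=
  ∃ (β₂ ℓ₂ c₂ C₂ s₁ s₂ : ℝ) (κ₂ n₀ : ℕ), 0 < s₁ ∧ s₁ < s₂ ∧ 0 < ℓ₂ ∧ 0 < c₂ ∧ ∀ β : ℝ, β₂ ≤ β →
    ∀ (c : Fin 4 → ℤ) (b : ℕ), (b : ℝ) * a β ≤ ℓ₂ → ∀ (η : LGConfig 4 G) (x y : Fin 4 → ℤ),
      s₁ ≤ ‖siteToE (y - x)‖ * a β → ‖siteToE (y - x)‖ * a β ≤ s₂ → (n₀ : ℝ) ≤ ‖siteToE (y - x)‖ →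
      (κ₂ : ℝ) * ‖siteToE (y - x)‖ ≤ depth c b x → (κ₂ : ℝ) * ‖siteToE (y - x)‖ ≤ depth c b y →
        c₂ ≤ ‖siteToE (y - x)‖ ^ 8 * kerCov G r β c b η (dens G r x) (dens G r y) ∧
        ‖siteToE (y - x)‖ ^ 8 * kerCov G r β c b η (dens G r x) (dens G r y) ≤ C₂

end Lattice

/-! ## §3 The inheritance stub (statement; provable now from the pieces, by the law of total covariance on the
femto TORUS containing the cube + `gate_solve_*` + `gate_propagate` + FlatShape2) -/

/-- **FitCondition** on H1's witnesses (the only place where the inherited architecture needs more than H1's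
logical form): the dimensionless axis amplitude is not `O(s⁸)` at `0⁺` along the unit map — for every `K` there are
femto data `(L, β, n)` with `n⁸·Cov ≥ K·(n a β)⁸`, i.e. `Cov_β(P_0, P_{n e₂}) ≥ K a(β)⁸`.  Physically `g⁴(s) ≫ s⁸`;
formally it follows from fixed-torus semiclassics (`Cov_{β,8}(P_0,P_{e₂}) ≍ β⁻²`) unless `a(β) ≳ β^{-1/4}`
(maps that slow violate H1's RG-chain two-sidedness, but unprovably so today). -/
def FitCondition (G : Type) [Group G] [TopologicalSpace G] [IsTopologicalGroup G] [CompactSpace G]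
    [MeasurableSpace G] [BorelSpace G] (r : LatticeRep G) (a : ℝ → ℝ) : Prop :=
  ∀ K : ℝ, ∃ (L : ℕ) (_ : NeZero L) (β : ℝ) (n : ℕ), 1 ≤ n ∧ 8 * n ≤ L ∧
    K * ((n : ℝ) * a β) ^ 8 ≤ (n : ℝ) ^ 8 *
      (wilsonExpectation (d := 4) (L := L) r.ρ β
          (fun U => ((r.N : ℝ) - (r.ρ (plaquetteHolonomy U 0 0 1)).trace.re) *
            ((r.N : ℝ) - (r.ρ (plaquetteHolonomy U (Pi.single (2 : Fin 4) ((n : ℕ) : ZMod L)) 0 1)).trace.re)) -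
        wilsonExpectation (d := 4) (L := L) r.ρ β (fun U => (r.N : ℝ) - (r.ρ (plaquetteHolonomy U 0 0 1)).trace.re) *
          wilsonExpectation (d := 4) (L := L) r.ρ β
            (fun U => (r.N : ℝ) - (r.ρ (plaquetteHolonomy U (Pi.single (2 : Fin 4) ((n : ℕ) : ZMod L)) 0 1)).trace.re))

/-- **Statement of `stub_inherit2`** (provable now from the pieces, by the law of total covariance on the femto
TORUS containing the cube + `gate_solve_*` + `gate_propagate` + FlatShape2): for a CONTINUOUS unit map,
H1 (periodic femto tori) ∧ FitCondition ∧ FBL6 ∧ Gate2 ∧ FlatShape2 ⇒ FC2I (two-sided conditional density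
covariances for EVERY exterior).  H1 is load-bearing: it pins the flat-box value `K(1)` two-sidedly through the
torus average `E_T[K(η)] = Cov_T − Cov_T(m, m)` (FBL6 bounds the second term by a sup, `(2C₁/d⁴)²`; Gate2 relates
every `K(η)` to `K(1)`); the collar of depth `κ‖y−x‖` must fit inside a femto cube inside a femto torus at a scale
where `Γ` beats `C₁²κ⁻⁸` — guaranteed at some window `[s₁, s₂]` by `FitCondition`. -/
def Statement.stub_inherit2 : Prop :=
  ∀ (G : Type) [Group G] [TopologicalSpace G] [IsTopologicalGroup G] [CompactSpace G]
    [MeasurableSpace G] [BorelSpace G], IsCompactSimpleLieGroup G →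
    ∀ (r : LatticeRep G) (a : ℝ → ℝ), Continuous a → TwoPoint G r a → FitCondition G r a →
      FBL6 G r a → Gate2 G r a → FlatShape2 G r a → FC2I G r a

/-- Sanity: under `Continuous a`, H1 already gives the interval-pinned package (landed), which is the form the
inheritance proof starts from. -/
example (G : Type) [Group G] [TopologicalSpace G] [IsTopologicalGroup G] [CompactSpace G]
    [MeasurableSpace G] [BorelSpace G] (r : LatticeRep G) (a : ℝ → ℝ)
    (ha : Continuous a) (h₁ : TwoPoint G r a) : TwoPointPinned G r a :=
  twoPointPinned_of_continuous G r a ha h₁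

end Summit.QuantumFields.YangMills.Cruxes.OSLegsAtWeakCouplingC.InheritedGates

end
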